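import Literature.MathematicalPhysics.QuantumLattice.HubbardDressedClusterTorusGeometry
import Literature.MathematicalPhysics.QuantumLattice.FermionGateDressingLightCone
import HarnessLib

/-!
# The seam-dressed cluster energy functional (certificate C3 of the `T > 0` Hubbard programme):
# windows, local gate layers, part marginals, and the per-box dressed energy `E_box(σ, W)` in `ℤ²` coordinates

Topic `Literature/MathematicalPhysics/QuantumLattice` (namespace = path; family `hubbard`). This file DEFINES — in
coordinates a certificate evaluator can reproduce digit by digit — the finite expression which the kernel theorem of
the sequel (`HubbardDressedClusterPressureFloor.lean`) proves to be a lower bound on the canonical pressure of the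
two-dimensional `t–t'` Hubbard model: `pressureTT' β t t' U n ≥ (S(σ) − β · SeamDressed.boxEnergy …)/(ab)`.

SETTING (the «C3» trial states of sr-mbsolver/hubbard-thermal, technique (ii): a box product state dressed by ONE
LAYER of disjoint gates across the box seams, in the Gibbs variational principle). Data: the box `[0,a) × [0,b) ⊆ ℤ²`
(`rectWindow a b`) carrying ONE density matrix `σ ∈ 𝔄_{[0,a)×[0,b)}` (repeated on every translate by the box lattice
`aℤ × bℤ`, `z(w) = (w₁ a, w₂ b)` = `SeamDressed.latticeVec`), and `m` reference gates: supports `G g ⊆ ℤ²` and unitaries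
`u g ∈ 𝔄_{G g}` (repeated on every translate `G g + z(w)`), SEPARATED: «two gate sites congruent modulo the box lattice are
the same site of the same gate» (all translates pairwise disjoint). For a Hamiltonian term `h ∈ 𝔄_S` (`S ⊆ ℤ²`, one or
two sites) the dressed expectation is computed on the WINDOW `Λ(S) = S ∪ ⋃ {G g + z(w) : (G g + z(w)) ∩ S ≠ ∅}`:

  `⟨h⟩_S = Re tr_{𝔄_Λ(S)} [ M_Λ(σ) · W_Λᴴ · Γ_{S ⊆ Λ}(h) · W_Λ ]`,

`W_Λ = Π_{(g,w) meeting S} Γ_{G g + z(w) ⊆ Λ}(u g)` the LOCAL GATE LAYER and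
`M_Λ(σ) = Π_{w : box(w) ∩ Λ ≠ ∅} Γ_{Λ ∩ box(w) ⊆ Λ}(tr_{Λ ∩ box(w) − z(w)} σ)` the product of the PART MARGINALS of `σ`
(each part of the window read back in the reference box); both are `boxProd`s (commuting products of even operators
on disjoint supports — the separation hypothesis and the evenness witnesses are arguments of the definitions). The
per-box energy is the FORWARD share of the box:

  `boxEnergy = Σ_{x ∈ [0,a)×[0,b)} [ U ⟨n_{x↑}n_{x↓}⟩_{{x}} − t (⟨hop⟩_{{x,x+e₀}} + ⟨hop⟩_{{x,x+e₁}})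
                                       − t' (⟨hop⟩_{{x,x+e₀+e₁}} + ⟨hop⟩_{{x,x+e₀−e₁}}) ]`,
  `hop_{y,y'} = Σ_σ (c†_{yσ} c_{y'σ} + c†_{y'σ} c_{yσ})`, and `boxDensity = Σ_x ⟨n_{x↑} + n_{x↓}⟩_{{x}}`.

All operators live on `Fock(PolySite Λ)` in the tree's Jordan–Wigner basis (sites of `ℤ²` in lexicographic order
(`x₀`-major), spin-minor, `↑ = 0`).

* §1 geometry of windows: `gateOffsets`, `meet`, `window`, `gateLeg`, `boxOffsets`, `part`, `partChart`, and the two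
  disjointness lemmas (`disjoint_gateLeg_of_sep`, `disjoint_partLeg`);
* §2 operators: `localDressing`, `localMarginal`, `locE`, the elementary terms `onsitePair`, `density`, `hop`;
* §3 `boxEnergy`, `boxDensity`.

Definitions with bodies plus their bookkeeping lemmas; no named fact. HONEST SCOPE: the functional is a finite sum of
traces of `4^{|Λ(S)|}`-dimensional matrices — it is meant to be CERTIFIED NUMERICALLY off-kernel (interval arithmetic)
and consumed through a claim node, exactly as the C2 open-box partition functions are.

## References

* M. Kliesch, C. Gogolin, M. J. Kastoryano, A. Riera, J. Eisert, Phys. Rev. X 4 (2014) 031019, §II (locality of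
  temperature; Gibbs states versus products of local states corrected across the cuts). [cite: KlieschEtAl2014, §II]
* O. Bratteli, D. W. Robinson, *Operator Algebras and Quantum Statistical Mechanics 2* (1997), §5.2.2, §6.2.4.
  [cite: BratteliRobinsonII1997, §5.2.2]
* Xu et al., Science 384 (2024) eadh7691, eq. (1) (the `t–t'–U` model). [cite: XuEtAl2024, eq. (1)]
-/

noncomputable section

namespace Literature.MathematicalPhysics.QuantumLattice

open Matrix Finset HubbardWave0 Literature.Probability.LatticeModels AndersonCluster
open scoped ComplexOrder BigOperators

namespace SeamDressed

/-! ### §1. Windows, local gate legs, parts -/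

section Geometry

variable (a b : ℕ) {m : ℕ} (G : Fin m → Finset (Site 2))

/-- The candidate offsets of gates meeting `S`: every `w` with `s = y + z(w)` for some `s ∈ S`, `y ∈ ⋃_g G g` is
`w = boxOf (s − y)`, so these exhaust the translates that can meet `S`. [cite: BratteliRobinsonII1997, §5.2.2] -/
def gateOffsets (S : Finset (Site 2)) : Finset (ℤ × ℤ) :=
  (S ×ˢ (Finset.univ : Finset (Fin m)).biUnion G).image fun p => boxOf a b (p.1 - p.2)

/-- **The gates meeting `S`**: pairs `(g, w)` (reference gate, box offset) whose translate `G g + z(w)` meets `S`.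
[cite: BratteliRobinsonII1997, §5.2.2] -/
def meet (S : Finset (Site 2)) : Finset (Fin m × (ℤ × ℤ)) :=
  ((Finset.univ : Finset (Fin m)) ×ˢ gateOffsets a b G S).filter fun k =>
    ¬ Disjoint (shiftSet (latticeVec a b k.2) (G k.1)) S

/-- **The dressed window** `Λ(S) = S ∪ ⋃_{(g,w) meeting S} (G g + z(w))`. [cite: BratteliRobinsonII1997, §5.2.2] -/
def window (S : Finset (Site 2)) : Finset (Site 2) :=
  S ∪ (meet a b G S).biUnion fun k => shiftSet (latticeVec a b k.2) (G k.1)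

/-- The term support lies in its window. [cite: BratteliRobinsonII1997, §5.2.2] -/
theorem subset_window (S : Finset (Site 2)) : S ⊆ window a b G S := by
  intro x hx
  rw [window, Finset.mem_union]
  exact Or.inl hx

/-- A meeting gate translate lies in the window. [cite: BratteliRobinsonII1997, §5.2.2] -/
theorem shiftSet_subset_window {S : Finset (Site 2)} {k : Fin m × (ℤ × ℤ)} (hk : k ∈ meet a b G S) :
    shiftSet (latticeVec a b k.2) (G k.1) ⊆ window a b G S := by
  intro x hx
  rw [window, Finset.mem_union, Finset.mem_biUnion]
  exact Or.inr ⟨k, hk, hx⟩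

/-- **The leg of a meeting gate into the window**: `y ↦ y + z(w)`. [cite: ArakiMoriya2003, §4.1 Def. 4.3] -/
def gateLeg (S : Finset (Site 2)) (k : ↥(meet a b G S)) : PolySite (G k.1.1) ↪ PolySite (window a b G S) :=
  (PolySite.shiftEmb (latticeVec a b k.1.2) (G k.1.1)).trans (PolySite.incl (shiftSet_subset_window a b G k.2))

/-- The gate leg on an ordered site (underlying site). [cite: ArakiMoriya2003, §4.1 Def. 4.3] -/
@[simp] theorem ofLex_coe_gateLeg (S : Finset (Site 2)) (k : ↥(meet a b G S)) (y : PolySite (G k.1.1)) :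
    ofLex (gateLeg a b G S k y).1 = ofLex y.1 + latticeVec a b k.1.2 := rfl

/-- **Separated gates have disjoint local legs**: under the separation hypothesis the legs of two distinct meeting
gates have disjoint images in the window. [cite: BratteliRobinsonII1997, §5.2.2] -/
theorem disjoint_gateLeg_of_sep [NeZero a] [NeZero b]
    (hsep : ∀ g g', ∀ x ∈ G g, ∀ x' ∈ G g', ((a : ℤ) ∣ x' 0 - x 0) → ((b : ℤ) ∣ x' 1 - x 1) → g = g' ∧ x = x')
    (S : Finset (Site 2)) : ∀ k j : ↥(meet a b G S), k ≠ j →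
    Disjoint ((Finset.univ : Finset (PolySite (G k.1.1))).map (gateLeg a b G S k))
      ((Finset.univ : Finset (PolySite (G j.1.1))).map (gateLeg a b G S j)) := by
  intro k j hkj
  rw [Finset.disjoint_left]
  rintro x hx hx'
  obtain ⟨y, -, rfl⟩ := Finset.mem_map.1 hx
  obtain ⟨y', -, hyy'⟩ := Finset.mem_map.1 hx'
  have h : ofLex y'.1 + latticeVec a b j.1.2 = ofLex y.1 + latticeVec a b k.1.2 := by
    have := congrArg (fun z : PolySite (window a b G S) => ofLex z.1) hyy'
    simpa using this
  have h0 : (a : ℤ) ∣ ofLex y.1 0 - ofLex y'.1 0 :=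
    ⟨j.1.2.1 - k.1.2.1, by have := congrFun h 0; simp only [Pi.add_apply, latticeVec_zero] at this; linarith⟩
  have h1 : (b : ℤ) ∣ ofLex y.1 1 - ofLex y'.1 1 :=
    ⟨j.1.2.2 - k.1.2.2, by have := congrFun h 1; simp only [Pi.add_apply, latticeVec_one] at this; linarith⟩
  obtain ⟨hg, hy⟩ := hsep j.1.1 k.1.1 (ofLex y'.1) (PolySite.ofLex_mem y') (ofLex y.1) (PolySite.ofLex_mem y) h0 h1
  have hw : j.1.2 = k.1.2 := by
    have ha : (a : ℤ) ≠ 0 := by exact_mod_cast NeZero.ne a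
    have hb : (b : ℤ) ≠ 0 := by exact_mod_cast NeZero.ne b
    have e0 := congrFun h 0
    have e1 := congrFun h 1
    simp only [Pi.add_apply, latticeVec_zero, latticeVec_one, hy, add_right_inj] at e0 e1
    exact Prod.ext (mul_right_cancel₀ ha e0) (mul_right_cancel₀ hb e1)
  exact hkj (Subtype.ext (Prod.ext hg hw)).symm

/-- **The boxes meeting the window**: their offsets. [cite: FriedliVelenik2017, §3.1] -/
def boxOffsets (S : Finset (Site 2)) : Finset (ℤ × ℤ) := (window a b G S).image (boxOf a b)

/-- **The part of the window in the box of offset `w`**: `Λ(S) ∩ ([0,a)×[0,b) + z(w))`.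
[cite: ArakiMoriya2003, §4.1 Def. 4.1 (2)] -/
def part (S : Finset (Site 2)) (w : ℤ × ℤ) : Finset (Site 2) := (window a b G S).filter fun y => boxOf a b y = w

/-- A part lies in the window. [cite: ArakiMoriya2003, §4.1 Def. 4.1 (2)] -/
theorem part_subset_window (S : Finset (Site 2)) (w : ℤ × ℤ) : part a b G S w ⊆ window a b G S :=
  Finset.filter_subset _ _

/-- Distinct parts are disjoint (as embedded in the window). [cite: ArakiMoriya2003, §4.1 Def. 4.1 (2)] -/
theorem disjoint_partLeg (S : Finset (Site 2)) : ∀ w w' : ↥(boxOffsets a b G S), w ≠ w' →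
    Disjoint ((Finset.univ : Finset (PolySite (part a b G S w.1))).map (PolySite.incl (part_subset_window a b G S w.1)))
      ((Finset.univ : Finset (PolySite (part a b G S w'.1))).map (PolySite.incl (part_subset_window a b G S w'.1))) := by
  intro w w' hww'
  rw [Finset.disjoint_left]
  rintro x hx hx'
  obtain ⟨y, -, rfl⟩ := Finset.mem_map.1 hx
  obtain ⟨y', -, hyy'⟩ := Finset.mem_map.1 hx'
  have h : ofLex y'.1 = ofLex y.1 := by
    have := congrArg (fun z : PolySite (window a b G S) => ofLex z.1) hyy'
    simpa using this
  have hw : boxOf a b (ofLex y.1) = w.1 := (Finset.mem_filter.1 (PolySite.ofLex_mem y)).2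
  have hw' : boxOf a b (ofLex y'.1) = w'.1 := (Finset.mem_filter.1 (PolySite.ofLex_mem y')).2
  rw [h, hw] at hw'
  exact hww' (Subtype.ext hw')

/-- Read back in the reference box, a site of the part of offset `w` is `y − z(w) ∈ [0,a)×[0,b)`.
[cite: FriedliVelenik2017, §3.1] -/
theorem sub_latticeVec_mem_rectWindow_of_mem_part [NeZero a] [NeZero b] {S : Finset (Site 2)} {w : ℤ × ℤ}
    {y : Site 2} (hy : y ∈ part a b G S w) : y - latticeVec a b w ∈ rectWindow a b := by
  have hw : boxOf a b y = w := (Finset.mem_filter.1 hy).2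
  rw [← hw]
  exact sub_latticeVec_boxOf_mem_rectWindow a b y

/-- **The chart of a part into the reference box**: `y ↦ y − z(w)`. [cite: ArakiMoriya2003, §4.1 Def. 4.3] -/
def partChart [NeZero a] [NeZero b] (S : Finset (Site 2)) (w : ℤ × ℤ) :
    PolySite (part a b G S w) ↪ PolySite (rectWindow a b) :=
  ⟨fun y => PolySite.pt (ofLex y.1 - latticeVec a b w)
      (sub_latticeVec_mem_rectWindow_of_mem_part a b G (PolySite.ofLex_mem y)),
    fun y y' hyy => by
      have h : ofLex y.1 - latticeVec a b w = ofLex y'.1 - latticeVec a b w :=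
        congrArg (fun z : PolySite (rectWindow a b) => ofLex z.1) hyy
      exact Subtype.ext (congrArg toLex (sub_left_injective h))⟩

/-- The chart on a site. [cite: ArakiMoriya2003, §4.1 Def. 4.3] -/
@[simp] theorem ofLex_coe_partChart [NeZero a] [NeZero b] (S : Finset (Site 2)) (w : ℤ × ℤ)
    (y : PolySite (part a b G S w)) : ofLex (partChart a b G S w y).1 = ofLex y.1 - latticeVec a b w := rfl

end Geometry

/-! ### §2. The local gate layer, the part marginals, the dressed local expectation -/

section Operators

variable (a b : ℕ) [NeZero a] [NeZero b] {m : ℕ} (G : Fin m → Finset (Site 2))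
  (hsep : ∀ g g', ∀ x ∈ G g, ∀ x' ∈ G g', ((a : ℤ) ∣ x' 0 - x 0) → ((b : ℤ) ∣ x' 1 - x 1) → g = g' ∧ x = x')
  (u : ∀ g, FermionOp (G g)) (hu : ∀ g, parityAut (u g) = u g)
  (σ : FermionOp (rectWindow a b)) (hσ : parityAut σ = σ)

/-- **The local gate layer** `W_Λ(S) = Π_{(g,w) meeting S} Γ_{G g + z(w) ⊆ Λ}(u g)` (a `boxProd` of the even gate
unitaries along the local legs; separated gates). [cite: BratteliRobinsonII1997, §5.2.2] -/
def localDressing (S : Finset (Site 2)) : FermionOp (window a b G S) :=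
  boxProd (disjoint_gateLeg_of_sep a b G hsep S) (fun k => u k.1.1) (fun k => hu k.1.1) Finset.univ

/-- **The product of the part marginals** `M_Λ(σ) = Π_{w} Γ_{part w ⊆ Λ}(tr_{part w − z(w)} σ)` over the boxes meeting
the window (a `boxProd` of the even marginals). [cite: ArakiMoriya2003, §11.1 Theorem 11.2] -/
def localMarginal (S : Finset (Site 2)) : FermionOp (window a b G S) :=
  boxProd (disjoint_partLeg a b G S) (fun w => fermionPartialTrace (partChart a b G S w.1) σ)
    (fun _ => parityAut_fermionPartialTrace_of_even _ hσ) Finset.univ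

/-- **The dressed local expectation** of a term `h ∈ 𝔄_S`:
`⟨h⟩_S = Re tr_{𝔄_Λ(S)} [M_Λ(σ) · W_Λᴴ · Γ_{S⊆Λ}(h) · W_Λ]`. [cite: KlieschEtAl2014, §II] -/
def locE (S : Finset (Site 2)) (h : FermionOp S) : ℝ :=
  (localMarginal a b G σ hσ S * ((localDressing a b G hsep u hu S)ᴴ *
    fermionEmbed (PolySite.incl (subset_window a b G S)) h * localDressing a b G hsep u hu S)).trace.re

omit hsep hu hσ

/-- The doublon `n_{x↑} n_{x↓} ∈ 𝔄_{{x}}`. [cite: XuEtAl2024, eq. (1)] -/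
def onsitePair (x : Site 2) : FermionOp ({x} : Finset (Site 2)) :=
  numberOp (PolySite.pt x (Finset.mem_singleton_self x)) 0 * numberOp (PolySite.pt x (Finset.mem_singleton_self x)) 1

/-- The site density `n_{x↑} + n_{x↓} ∈ 𝔄_{{x}}`. [cite: XuEtAl2024, eq. (1)] -/
def density (x : Site 2) : FermionOp ({x} : Finset (Site 2)) :=
  numberOp (PolySite.pt x (Finset.mem_singleton_self x)) 0 + numberOp (PolySite.pt x (Finset.mem_singleton_self x)) 1

/-- The symmetric hopping `Σ_σ (c†_{xσ} c_{yσ} + c†_{yσ} c_{xσ}) ∈ 𝔄_{{x,y}}`. [cite: XuEtAl2024, eq. (1)] -/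
def hop (x y : Site 2) : FermionOp ({x, y} : Finset (Site 2)) :=
  ∑ s : Fin 2,
    (creation (orb (PolySite.pt x (Finset.mem_insert_self x {y})) s) *
        annihilation (orb (PolySite.pt y (Finset.mem_insert_of_mem (Finset.mem_singleton_self y))) s) +
      creation (orb (PolySite.pt y (Finset.mem_insert_of_mem (Finset.mem_singleton_self y))) s) *
        annihilation (orb (PolySite.pt x (Finset.mem_insert_self x {y})) s))

/-! ### §3. The per-box dressed energy and density -/

/-- **The per-box dressed energy `E_box(σ, W)`** of the `t–t'–U` Hubbard model (FORWARD share of the box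
`[0,a) × [0,b)`: the doublon of every box site and the bonds `(x, x+e₀)`, `(x, x+e₁)`, `(x, x+e₀+e₁)`, `(x, x+e₀−e₁)`
issuing from it). [cite: XuEtAl2024, eq. (1)] [cite: KlieschEtAl2014, §II] -/
def boxEnergy (t t' U : ℝ) : ℝ :=
  ∑ x ∈ rectWindow a b,
    (U * locE a b G hsep u hu σ hσ {x} (onsitePair x)
      - t * (locE a b G hsep u hu σ hσ {x, x + unitVec 0} (hop x (x + unitVec 0))
          + locE a b G hsep u hu σ hσ {x, x + unitVec 1} (hop x (x + unitVec 1)))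
      - t' * (locE a b G hsep u hu σ hσ {x, x + unitVec 0 + unitVec 1} (hop x (x + unitVec 0 + unitVec 1))
          + locE a b G hsep u hu σ hσ {x, x + unitVec 0 - unitVec 1} (hop x (x + unitVec 0 - unitVec 1))))

/-- **The per-box dressed density** `Σ_{x ∈ box} ⟨n_{x↑} + n_{x↓}⟩_{{x}}` (`= Re tr(σN)` for number-conserving gates,
proved in the sequel). [cite: XuEtAl2024, eq. (1)] -/
def boxDensity : ℝ :=
  ∑ x ∈ rectWindow a b, locE a b G hsep u hu σ hσ {x} (density x)

end Operators

end SeamDressed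

end Literature.MathematicalPhysics.QuantumLattice

end
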